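import Summits.KontsevichZagierPeriods.KontsevichZagierPeriods.Theorems.RealOnePeriodRelations.Negative.Kit
import Literature.NumberTheory.Transcendental.CurvePeriodsProofs
import Literature.NumberTheory.Transcendental.KZSemialgebraicComplex
import Literature.NumberTheory.Transcendental.KZPeriodsProofs
import Literature.NumberTheory.Transcendental.SemialgebraicDerivativeProofs
import Literature.NumberTheory.Transcendental.SemialgebraicMapsProofs

/-!
# `RealOnePeriodRelations` (stmt-KontsevichZagierPeriods-10042), line `nash-retraction-thin-strip`:
# stub `stub_realises` — real realisations of period symbols exist

For a `ℚ`-semialgebraic `C¹` path `γ : [0,1] → Z(ℂ) ⊂ ℂⁿ` (a `CurvePeriods.CurvePath` whose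
realification is a `ℚ`-semialgebraic map on `[0,1]`), a polynomial `1`-form `ω = Σᵢ ωᵢ dxᵢ` with
algebraic coefficients and an algebraic scalar `a`, the function
`t ↦ Re (a · Σᵢ ωᵢ(γ(t)) · γᵢ′(t))` on `(0,1)` is the integrand of a 1-dimensional
Kontsevich–Zagier integral representation (`KZ.IntegralRep 1` on the unit interval): it is
`ℚ`-semialgebraic (real/imaginary-part calculus of `KZSemialgebraicComplex`, derivatives of
semialgebraic functions are semialgebraic — Basu–Pollack–Roy Prop. 3.22, tree theorem
`IsSemialgebraicFunOn.hasDerivAt_isSemialgebraic_holds`) and absolutely integrable (it agrees on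
`(0,1)` with a function continuous on `[0,1]`). This is the registered stub `stub_realises` of the
lead skeleton `Cruxes/RealOnePeriodRelations/Lines/nash-retraction-thin-strip.lean`: the retraction
`Θ` of the line sends `a · (Z, ω, γ)` to `[∫₀¹ Re(a·ω(γ̃)γ̃′) dt]`, and this file supplies that
representation.

References: M. Kontsevich, D. Zagier, *Periods* (2001), §1.1; S. Basu, R. Pollack, M.-F. Roy,
*Algorithms in Real Algebraic Geometry* (2006), Prop. 3.22; A. Huber, G. Wüstholz, *Transcendence
and Linear Relations of 1-Periods* (2022), Cor. 12.7.
-/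

noncomputable section

open scoped BigOperators
open Set MeasureTheory MvPolynomial
open Literature.NumberTheory.Transcendental Literature.NumberTheory.Transcendental.CurvePeriods
open Literature.ModelTheory.ExponentialFields (IsSemialgebraic)
open Summit.KontsevichZagierPeriods.SymplecticScissors.RealOnePeriodRelationsNegative (unitDom)

namespace Summit.KontsevichZagierPeriods.SymplecticScissors.RealOnePeriodRelations

namespace Realises

/-! ## Semialgebraic bookkeeping on `ℝ¹` -/

/-- The closed unit interval `{z | z 0 ∈ [0,1]} ⊂ ℝ¹` is `ℚ`-semialgebraic (`0 ≤ z₀` and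
`0 ≤ 1 − z₀`). [folklore] -/
theorem isSemialgebraic_IccDom : IsSemialgebraic ℚ {z : Fin 1 → ℝ | z 0 ∈ Set.Icc (0 : ℝ) 1} := by
  have h1 := Literature.ModelTheory.ExponentialFields.isSemialgebraic_setOf_eval_nonneg (k := ℚ)
    (R := ℝ) (MvPolynomial.X (0 : Fin 1) : MvPolynomial (Fin 1) ℚ)
  have h2 := Literature.ModelTheory.ExponentialFields.isSemialgebraic_setOf_eval_nonneg (k := ℚ)
    (R := ℝ) (1 - MvPolynomial.X (0 : Fin 1) : MvPolynomial (Fin 1) ℚ)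
  have hset : {z : Fin 1 → ℝ | z 0 ∈ Set.Icc (0 : ℝ) 1} =
      {x : Fin 1 → ℝ | 0 ≤ MvPolynomial.aeval x (MvPolynomial.X (0 : Fin 1) : MvPolynomial (Fin 1) ℚ)} ∩
      {x : Fin 1 → ℝ | 0 ≤ MvPolynomial.aeval x (1 - MvPolynomial.X (0 : Fin 1) : MvPolynomial (Fin 1) ℚ)} := by
    ext z
    simp [sub_nonneg]
  rw [hset]
  exact h1.inter h2

/-- `unitDom ⊆ {z | z 0 ∈ [0,1]}`. [folklore] -/
theorem unitDom_subset_IccDom : unitDom ⊆ {z : Fin 1 → ℝ | z 0 ∈ Set.Icc (0 : ℝ) 1} :=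
  fun _ hz => Ioo_subset_Icc_self hz

/-- The real and imaginary parts of the coordinates of a `ℚ`-semialgebraic path are
`ℚ`-semialgebraic functions on `[0,1]`. [cite: BochnakCosteRoy1998, §2.2] -/
theorem re_im_coord_of_path {n : ℕ} {γ : ℝ → (Fin n → ℂ)}
    (hγ : IsSemialgebraicMapOn ℚ {z : Fin 1 → ℝ | z 0 ∈ Set.Icc (0 : ℝ) 1}
      (fun z => Fin.append (fun i => (γ (z 0) i).re) (fun i => (γ (z 0) i).im))) (i : Fin n) :
    IsSemialgebraicFunOn ℚ {z : Fin 1 → ℝ | z 0 ∈ Set.Icc (0 : ℝ) 1} (fun z => (γ (z 0) i).re) ∧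
      IsSemialgebraicFunOn ℚ {z : Fin 1 → ℝ | z 0 ∈ Set.Icc (0 : ℝ) 1} (fun z => (γ (z 0) i).im) := by
  have h := (isSemialgebraicMapOn_iff_forall_holds (k := ℚ) isSemialgebraic_IccDom).mp hγ
  refine ⟨(h (Fin.castAdd n i)).congr fun z _ => ?_, (h (Fin.natAdd n i)).congr fun z _ => ?_⟩
  · exact Fin.append_left _ _ i
  · exact Fin.append_right _ _ i

/-- Finite sums of complex-valued functions with semialgebraic real and imaginary parts.
[cite: BochnakCosteRoy1998, Prop. 2.2.6] -/
theorem re_im_sum {m : ℕ} {s : Set (Fin m → ℝ)} (hs : IsSemialgebraic ℚ s) {ι : Type*}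
    (I : Finset ι) {F : ι → (Fin m → ℝ) → ℂ}
    (hF : ∀ j ∈ I, IsSemialgebraicFunOn ℚ s (fun x => (F j x).re) ∧
      IsSemialgebraicFunOn ℚ s (fun x => (F j x).im)) :
    IsSemialgebraicFunOn ℚ s (fun x => (∑ j ∈ I, F j x).re) ∧
      IsSemialgebraicFunOn ℚ s (fun x => (∑ j ∈ I, F j x).im) := by
  classical
  induction I using Finset.induction_on with
  | empty =>
    refine ⟨?_, ?_⟩
    · simpa using isSemialgebraicFunOn_natCast (k := ℚ) (R := ℝ) hs 0
    · simpa using isSemialgebraicFunOn_natCast (k := ℚ) (R := ℝ) hs 0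
  | insert j I hj ih =>
    have h := re_im_add (hF j (Finset.mem_insert_self j I))
      (ih fun k hk => hF k (Finset.mem_insert_of_mem hk))
    simpa [Finset.sum_insert hj] using h

/-- Finite products of complex-valued functions with semialgebraic real and imaginary parts.
[cite: BochnakCosteRoy1998, Prop. 2.2.6] -/
theorem re_im_prod {m : ℕ} {s : Set (Fin m → ℝ)} (hs : IsSemialgebraic ℚ s) {ι : Type*}
    (I : Finset ι) {F : ι → (Fin m → ℝ) → ℂ}
    (hF : ∀ j ∈ I, IsSemialgebraicFunOn ℚ s (fun x => (F j x).re) ∧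
      IsSemialgebraicFunOn ℚ s (fun x => (F j x).im)) :
    IsSemialgebraicFunOn ℚ s (fun x => (∏ j ∈ I, F j x).re) ∧
      IsSemialgebraicFunOn ℚ s (fun x => (∏ j ∈ I, F j x).im) := by
  classical
  induction I using Finset.induction_on with
  | empty =>
    refine ⟨?_, ?_⟩
    · simpa using isSemialgebraicFunOn_natCast (k := ℚ) (R := ℝ) hs 1
    · simpa using isSemialgebraicFunOn_natCast (k := ℚ) (R := ℝ) hs 0
  | insert j I hj ih =>
    have h := re_im_mul (hF j (Finset.mem_insert_self j I))
      (ih fun k hk => hF k (Finset.mem_insert_of_mem hk))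
    simpa [Finset.prod_insert hj] using h

/-- Evaluation of a polynomial with algebraic coefficients at a vector of complex-valued functions
with semialgebraic real and imaginary parts has semialgebraic real and imaginary parts.
[cite: KontsevichZagier2001, §1.1] -/
theorem re_im_eval {m n : ℕ} {s : Set (Fin m → ℝ)} (hs : IsSemialgebraic ℚ s)
    {F : (Fin m → ℝ) → (Fin n → ℂ)}
    (hF : ∀ i, IsSemialgebraicFunOn ℚ s (fun x => (F x i).re) ∧
      IsSemialgebraicFunOn ℚ s (fun x => (F x i).im))
    (P : MvPolynomial (Fin n) ℂ) (hP : HasAlgCoeffs P) :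
    IsSemialgebraicFunOn ℚ s (fun x => (MvPolynomial.eval (F x) P).re) ∧
      IsSemialgebraicFunOn ℚ s (fun x => (MvPolynomial.eval (F x) P).im) := by
  have key : IsSemialgebraicFunOn ℚ s
      (fun x => (∑ d ∈ P.support, P.coeff d * ∏ i, F x i ^ d i).re) ∧
      IsSemialgebraicFunOn ℚ s (fun x => (∑ d ∈ P.support, P.coeff d * ∏ i, F x i ^ d i).im) := by
    refine re_im_sum hs P.support fun d _ => ?_
    refine re_im_mul ?_ (re_im_prod hs Finset.univ fun i _ => re_im_pow hs (hF i) (d i))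
    have halg := isAlgebraic_re_im (hP d)
    exact re_im_const hs halg.1 halg.2
  refine ⟨key.1.congr fun x _ => ?_, key.2.congr fun x _ => ?_⟩
  · simp only [MvPolynomial.eval_eq']
  · simp only [MvPolynomial.eval_eq']

/-! ## The derivative of a semialgebraic `C¹` path -/

variable {Z : CurveData}

/-- The real part of a coordinate of a `C¹` path has, at interior times, derivative the real part
of the derivative. [folklore] -/
theorem hasDerivAt_re (γ : CurvePath Z) {t : ℝ} (ht : t ∈ Ioo (0 : ℝ) 1) (i : Fin Z.n) :
    HasDerivAt (fun u => (γ.toFun u i).re) (deriv (fun u => γ.toFun u i) t).re t := by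
  have h := (Complex.reCLM.hasFDerivAt).comp_hasDerivAt t (γ.hasDerivAt ht i)
  simpa [Function.comp_def] using h

/-- The imaginary part of a coordinate of a `C¹` path has, at interior times, derivative the
imaginary part of the derivative. [folklore] -/
theorem hasDerivAt_im (γ : CurvePath Z) {t : ℝ} (ht : t ∈ Ioo (0 : ℝ) 1) (i : Fin Z.n) :
    HasDerivAt (fun u => (γ.toFun u i).im) (deriv (fun u => γ.toFun u i) t).im t := by
  have h := (Complex.imCLM.hasFDerivAt).comp_hasDerivAt t (γ.hasDerivAt ht i)
  simpa [Function.comp_def] using h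

/-- **The velocity of a semialgebraic `C¹` path is semialgebraic**: real and imaginary parts of
`γᵢ′` are `ℚ`-semialgebraic functions on `(0,1)` (Basu–Pollack–Roy Prop. 3.22, tree theorem
`IsSemialgebraicFunOn.hasDerivAt_isSemialgebraic_holds`). [cite: BasuPollackRoy2006, Prop. 3.22] -/
theorem re_im_deriv (γ : CurvePath Z)
    (hγ : IsSemialgebraicMapOn ℚ {z : Fin 1 → ℝ | z 0 ∈ Set.Icc (0 : ℝ) 1}
      (fun z => Fin.append (fun i => (γ.toFun (z 0) i).re) (fun i => (γ.toFun (z 0) i).im)))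
    (i : Fin Z.n) :
    IsSemialgebraicFunOn ℚ unitDom (fun z => (deriv (fun u => γ.toFun u i) (z 0)).re) ∧
      IsSemialgebraicFunOn ℚ unitDom (fun z => (deriv (fun u => γ.toFun u i) (z 0)).im) := by
  have hc := re_im_coord_of_path hγ i
  have hsub := unitDom_subset_IccDom
  have husa : IsSemialgebraic ℚ unitDom :=
    Summit.KontsevichZagierPeriods.SymplecticScissors.RealOnePeriodRelationsNegative.isSemialgebraic_unitDom
  refine ⟨?_, ?_⟩
  · exact IsSemialgebraicFunOn.hasDerivAt_isSemialgebraic_holds 0 1 (fun u => (γ.toFun u i).re)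
      (fun u => (deriv (fun u => γ.toFun u i) u).re) zero_lt_one (hc.1.mono hsub husa)
      (fun x hx => hasDerivAt_re γ hx i)
  · exact IsSemialgebraicFunOn.hasDerivAt_isSemialgebraic_holds 0 1 (fun u => (γ.toFun u i).im)
      (fun u => (deriv (fun u => γ.toFun u i) u).im) zero_lt_one (hc.2.mono hsub husa)
      (fun x hx => hasDerivAt_im γ hx i)

/-! ## The realisation -/

/-- The real integrand `t ↦ Re (a · Σᵢ ωᵢ(γ(t)) · γᵢ′(t))` is `ℚ`-semialgebraic on `(0,1) ⊂ ℝ¹`.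
[cite: KontsevichZagier2001, §1.1] -/
theorem isSemialgebraicFunOn_integrand (γ : CurvePath Z)
    (hγ : IsSemialgebraicMapOn ℚ {z : Fin 1 → ℝ | z 0 ∈ Set.Icc (0 : ℝ) 1}
      (fun z => Fin.append (fun i => (γ.toFun (z 0) i).re) (fun i => (γ.toFun (z 0) i).im)))
    (ω : Fin Z.n → MvPolynomial (Fin Z.n) ℂ) (hω : ∀ i, HasAlgCoeffs (ω i))
    (a : ℂ) (ha : IsAlgebraic ℚ a) :
    IsSemialgebraicFunOn ℚ unitDom (fun z => (a * ∑ i, MvPolynomial.eval (γ.toFun (z 0)) (ω i) *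
      deriv (fun u => γ.toFun u i) (z 0)).re) := by
  have husa : IsSemialgebraic ℚ unitDom :=
    Summit.KontsevichZagierPeriods.SymplecticScissors.RealOnePeriodRelationsNegative.isSemialgebraic_unitDom
  have hsub := unitDom_subset_IccDom
  have hcoord : ∀ i, IsSemialgebraicFunOn ℚ unitDom (fun z => (γ.toFun (z 0) i).re) ∧
      IsSemialgebraicFunOn ℚ unitDom (fun z => (γ.toFun (z 0) i).im) := fun i =>
    ⟨(re_im_coord_of_path hγ i).1.mono hsub husa, (re_im_coord_of_path hγ i).2.mono hsub husa⟩
  have halg := isAlgebraic_re_im ha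
  have h := re_im_mul (re_im_const husa halg.1 halg.2)
    (re_im_sum husa Finset.univ fun i _ =>
      re_im_mul (re_im_eval husa hcoord (ω i) (hω i)) (re_im_deriv γ hγ i))
  exact h.1

/-- The continuous model of the integrand on `[0,1]` (one-sided derivatives) is continuous there.
[folklore] -/
theorem continuousOn_integrandIcc (γ : CurvePath Z) (ω : Fin Z.n → MvPolynomial (Fin Z.n) ℂ)
    (a : ℂ) : ContinuousOn (fun t => (a * ∑ i, MvPolynomial.eval (γ.toFun t) (ω i) *
      derivWithin (fun u => γ.toFun u i) (Icc 0 1) t).re) (Icc 0 1) := by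
  have h : ContinuousOn (fun t => ∑ i, MvPolynomial.eval (γ.toFun t) (ω i) *
      derivWithin (fun u => γ.toFun u i) (Icc 0 1) t) (Icc 0 1) :=
    continuousOn_finsetSum _ fun i _ => (γ.continuousOn_eval (ω i)).mul (γ.continuousOn_derivWithin i)
  exact Complex.continuous_re.comp_continuousOn (continuousOn_const.mul h)

/-- On `(0,1)` the integrand is the continuous model. [folklore] -/
theorem integrand_eq_integrandIcc (γ : CurvePath Z) (ω : Fin Z.n → MvPolynomial (Fin Z.n) ℂ)
    (a : ℂ) {z : Fin 1 → ℝ} (hz : z ∈ unitDom) :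
    (a * ∑ i, MvPolynomial.eval (γ.toFun (z 0)) (ω i) * deriv (fun u => γ.toFun u i) (z 0)).re =
      (a * ∑ i, MvPolynomial.eval (γ.toFun (z 0)) (ω i) *
        derivWithin (fun u => γ.toFun u i) (Icc 0 1) (z 0)).re := by
  have h : ∀ i, deriv (fun u => γ.toFun u i) (z 0) =
      derivWithin (fun u => γ.toFun u i) (Icc 0 1) (z 0) := fun i => (γ.derivWithin_eq_deriv hz i).symm
  simp only [h]

/-- The real integrand is integrable on `(0,1) ⊂ ℝ¹`. [folklore] -/
theorem integrableOn_integrand (γ : CurvePath Z) (ω : Fin Z.n → MvPolynomial (Fin Z.n) ℂ)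
    (a : ℂ) : IntegrableOn (fun z : Fin 1 → ℝ => (a * ∑ i, MvPolynomial.eval (γ.toFun (z 0)) (ω i) *
      deriv (fun u => γ.toFun u i) (z 0)).re) unitDom := by
  -- integrability of the continuous model on `(0,1) ⊆ ℝ`
  have hIoo : IntegrableOn (fun t => (a * ∑ i, MvPolynomial.eval (γ.toFun t) (ω i) *
      derivWithin (fun u => γ.toFun u i) (Icc 0 1) t).re) (Ioo 0 1) :=
    ((continuousOn_integrandIcc γ ω a).integrableOn_compact isCompact_Icc).mono_set
      Ioo_subset_Icc_self
  -- transfer along `ℝ¹ ≃ ℝ`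
  have hmp : MeasurePreserving (MeasurableEquiv.funUnique (Fin 1) ℝ) volume volume :=
    volume_preserving_funUnique (Fin 1) ℝ
  have h1 : IntegrableOn ((fun t => (a * ∑ i, MvPolynomial.eval (γ.toFun t) (ω i) *
      derivWithin (fun u => γ.toFun u i) (Icc 0 1) t).re) ∘ MeasurableEquiv.funUnique (Fin 1) ℝ)
      (MeasurableEquiv.funUnique (Fin 1) ℝ ⁻¹' Ioo 0 1) :=
    (hmp.integrableOn_comp_preimage (MeasurableEquiv.measurableEmbedding _)).mpr hIoo
  rw [Summit.KontsevichZagierPeriods.SymplecticScissors.RealOnePeriodRelationsNegative.funUnique_preimage_Ioo]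
    at h1
  refine h1.congr_fun (fun z hz => ?_)
    Summit.KontsevichZagierPeriods.SymplecticScissors.RealOnePeriodRelationsNegative.measurableSet_unitDom
  simp only [Function.comp_apply, MeasurableEquiv.funUnique_apply, Fin.default_eq_zero]
  exact (integrand_eq_integrandIcc γ ω a hz).symm

end Realises

/-- **Stub `stub_realises`** of line `nash-retraction-thin-strip` (crux `RealOnePeriodRelations`):
along a `ℚ`-semialgebraic `C¹` path `γ` on `Z` with algebraic end points, for every polynomial form
`ω` over `ℚ̄` and algebraic scalar `a`, there is a 1-dimensional KZ representation on `(0,1)` whose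
integrand is `t ↦ Re(a · Σᵢ ωᵢ(γ(t)) γᵢ′(t))`. [cite: KontsevichZagier2001, §1.1] -/
theorem stub_realises : ∀ (Z : CurveData) (γ : CurvePath Z),
    IsSemialgebraicMapOn ℚ {z : Fin 1 → ℝ | z 0 ∈ Set.Icc (0 : ℝ) 1}
      (fun z => Fin.append (fun i => (γ.toFun (z 0) i).re) (fun i => (γ.toFun (z 0) i).im)) →
    ∀ (ω : Fin Z.n → MvPolynomial (Fin Z.n) ℂ), (∀ i, HasAlgCoeffs (ω i)) → ∀ (a : ℂ), IsAlgebraic ℚ a →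
    ∃ r : KZ.IntegralRep 1, r.domain = {z | z 0 ∈ Set.Ioo (0 : ℝ) 1} ∧ ∀ z ∈ r.domain, r.integrand z =
      (a * ∑ i, MvPolynomial.eval (γ.toFun (z 0)) (ω i) * deriv (fun u => γ.toFun u i) (z 0)).re :=
  fun _ γ hγ ω hω a ha =>
    ⟨⟨unitDom, fun z => (a * ∑ i, MvPolynomial.eval (γ.toFun (z 0)) (ω i) *
        deriv (fun u => γ.toFun u i) (z 0)).re,
      Summit.KontsevichZagierPeriods.SymplecticScissors.RealOnePeriodRelationsNegative.isSemialgebraic_unitDom,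
      Realises.isSemialgebraicFunOn_integrand γ hγ ω hω a ha, Realises.integrableOn_integrand γ ω a⟩,
      rfl, fun _ _ => rfl⟩

end Summit.KontsevichZagierPeriods.SymplecticScissors.RealOnePeriodRelations

end
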